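import Literature.Probability.LatticeModels.MarkovWindowDensity
import Literature.MathematicalPhysics.KineticTheory.InfiniteChainSpecificationLocality
import HarnessLib

/-!
# Peeling the finite-volume Gibbs integrals of a nearest-neighbour chain down to iterates of the
# transfer kernel (marginal-integral form)

Topic `Literature/MathematicalPhysics/KineticTheory`; theorems only (no definitions, no named
facts). Generic bookkeeping on the configuration space `ℤ → S` of a one-dimensional
nearest-neighbour model with a priori measure `ν` on `S`, one-site weight `w : S → ℝ≥0∞` and bond
transfer kernel `k : S → S → ℝ≥0∞` (for the oscillator chain: `S = ℝ × ℝ`, `ν` Lebesgue,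
`w = e^{-(p²/2+U(q))/T}`, `k(z, z') = e^{-V(q'-q)/T}`, cf. `OscillatorChain.ofReal_exp_neg_hamiltonianIn`),
written with Mathlib's marginal integrals `∫⋯∫⁻_s, f ∂ν` (`MeasureTheory.lmarginal`) and WITHOUT
definitions: the PATH WEIGHT of the block of sites `c+1, …, c+M` attached to the site `c`,
`∏_{i<M} k(σ_{c+i}, σ_{c+i+1}) w(σ_{c+i+1})`, and the POINTWISE TRANSFER OPERATOR
`(κ F)(x) = ∫⁻ k(x, y) w(y) F(y) dν(y)` are spelled out.

* `prod_Icc_eq_prod_range'`, `prod_Icc_siteWeight_mul_prod_Icc_bond` — the Boltzmann weight of an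
  interval `∏_{x ∈ {c+1,…,c+M}} w(σ_x) ∏_{y ∈ {c,…,c+M}} k(σ_y, σ_{y+1})` is the path weight times the
  last bond factor `k(σ_{c+M}, σ_{c+M+1})`;
* `measurable_pathWeight`, `dependsOn_pathWeight`, `pathWeight_add` — bookkeeping;
* `lmarginal_Icc_pathWeight_mul` — **peeling**: integrating the block `{c+1, …, c+M}` against the
  path weight and a function `F` of the last site gives the `M`-th iterate `(κ^M F)(σ_c)` (Markov
  property; induction on `M`, one `lmarginal_insert'` per site);
* `lmarginal_congr_of_forall_eq` — a marginal integral over `s` only reads the integrand on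
  configurations agreeing with the base point off `s`.

The two-sided peel of a whole interval (left block, window, right block) built on these lemmas is
`lmarginal_interval_eq_iterate` in `InfiniteChainIntervalPeel.lean`; together they form the
"interval kernel = transfer-operator matrix element" step of the classical proof of uniqueness of
the (tempered / shift-invariant) Gibbs state of one-dimensional models with strictly positive
transfer kernels (Cassandro–Olivieri–Pellegrinotti–Presutti 1978 §2; Georgii 2011, Thm 10.25,
§11.1). [folklore]
-/

noncomputable section

open MeasureTheory Set Function Finset Literature.Probability.LatticeModels
open scoped ENNReal

namespace Literature.MathematicalPhysics.KineticTheory.HeatConduction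

variable {S : Type*} [MeasurableSpace S] {ν : Measure S} {k : S → S → ℝ≥0∞} {w : S → ℝ≥0∞}

/-! ### Interval products as path weights -/

omit [MeasurableSpace S] in
/-- Reindexing a product over the window `{c, …, c+m}` by `j ↦ c + j`, `j ≤ m`. [folklore] -/
theorem prod_Icc_eq_prod_range' {M : Type*} [CommMonoid M] (f : ℤ → M) (c : ℤ) (m : ℕ) :
    ∏ i ∈ Finset.Icc c (c + m), f i = ∏ j ∈ Finset.range (m + 1), f (c + j) := by
  refine Finset.prod_nbij' (fun i : ℤ => (i - c).toNat) (fun j : ℕ => c + (j : ℤ)) ?_ ?_ ?_ ?_ ?_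
  · intro i hi
    rw [Finset.mem_Icc] at hi
    exact Finset.mem_range.2 (by omega)
  · intro j hj
    rw [Finset.mem_range] at hj
    rw [Finset.mem_Icc]
    omega
  · intro i hi
    rw [Finset.mem_Icc] at hi
    rw [Int.toNat_of_nonneg (by omega)]
    ring
  · intro j _
    simp
  · intro i hi
    rw [Finset.mem_Icc] at hi
    congr 1
    rw [Int.toNat_of_nonneg (by omega)]
    ring

omit [MeasurableSpace S] in
/-- Reindexing a product over the block `{c+1, …, c+M}` by `j ↦ c + j + 1`, `j < M`. [folklore] -/
theorem prod_Icc_succ_eq_prod_range {M : Type*} [CommMonoid M] (f : ℤ → M) (c : ℤ) (m : ℕ) :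
    ∏ i ∈ Finset.Icc (c + 1) (c + m), f i = ∏ j ∈ Finset.range m, f (c + j + 1) := by
  refine Finset.prod_nbij' (fun i : ℤ => (i - c - 1).toNat) (fun j : ℕ => c + (j : ℤ) + 1)
    ?_ ?_ ?_ ?_ ?_
  · intro i hi
    rw [Finset.mem_Icc] at hi
    exact Finset.mem_range.2 (by omega)
  · intro j hj
    rw [Finset.mem_range] at hj
    rw [Finset.mem_Icc]
    omega
  · intro i hi
    rw [Finset.mem_Icc] at hi
    rw [Int.toNat_of_nonneg (by omega)]
    ring
  · intro j _
    omega
  · intro i hi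
    rw [Finset.mem_Icc] at hi
    congr 1
    rw [Int.toNat_of_nonneg (by omega)]
    ring

omit [MeasurableSpace S] in
/-- **The Boltzmann weight of an interval is a path weight times the last bond factor**:
`∏_{x∈{c+1,…,c+M}} w(σ_x) ∏_{y∈{c,…,c+M}} k(σ_y, σ_{y+1})
 = (∏_{i<M} k(σ_{c+i}, σ_{c+i+1}) w(σ_{c+i+1})) · k(σ_{c+M}, σ_{c+M+1})`. [folklore] -/
theorem prod_Icc_siteWeight_mul_prod_Icc_bond (c : ℤ) (M : ℕ) (σ : ℤ → S) :
    (∏ x ∈ Finset.Icc (c + 1) (c + M), w (σ x)) * ∏ y ∈ Finset.Icc c (c + M), k (σ y) (σ (y + 1)) =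
      (∏ i ∈ Finset.range M, k (σ (c + i)) (σ (c + i + 1)) * w (σ (c + i + 1))) *
        k (σ (c + M)) (σ (c + M + 1)) := by
  rw [prod_Icc_succ_eq_prod_range, prod_Icc_eq_prod_range', Finset.prod_range_succ,
    Finset.prod_mul_distrib]
  ring

/-! ### The path weight -/

/-- Measurability of the path weight `σ ↦ ∏_{i<M} k(σ_{c+i}, σ_{c+i+1}) w(σ_{c+i+1})`. [folklore] -/
theorem measurable_pathWeight (hk : Measurable (uncurry k)) (hw : Measurable w) (c : ℤ) (M : ℕ) :
    Measurable fun σ : ℤ → S =>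
      ∏ i ∈ Finset.range M, k (σ (c + i)) (σ (c + i + 1)) * w (σ (c + i + 1)) :=
  Finset.measurable_prod _ fun _ _ =>
    (measurable_kernel_eval hk _ _).mul (measurable_comp_eval hw _)

omit [MeasurableSpace S] in
/-- The path weight of the block `{c+1, …, c+M}` reads the configuration only on `{c, …, c+M}`.
[folklore] -/
theorem dependsOn_pathWeight (c : ℤ) (M : ℕ) :
    DependsOn (fun σ : ℤ → S =>
      ∏ i ∈ Finset.range M, k (σ (c + i)) (σ (c + i + 1)) * w (σ (c + i + 1)))
      (↑(Finset.Icc c (c + M)) : Set ℤ) := by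
  intro x y hxy
  simp only [Finset.coe_Icc, Set.mem_Icc] at hxy
  refine Finset.prod_congr rfl fun i hi => ?_
  rw [Finset.mem_range] at hi
  rw [hxy (c + i) ⟨by omega, by omega⟩, hxy (c + i + 1) ⟨by omega, by omega⟩]

omit [MeasurableSpace S] in
/-- **Concatenation of blocks**: the path weight of `M + M'` sites is the path weight of the first
`M` sites times that of the next `M'` sites (attached to the site `c + M`). [folklore] -/
theorem pathWeight_add (c : ℤ) (M M' : ℕ) (σ : ℤ → S) :
    ∏ i ∈ Finset.range (M + M'), k (σ (c + i)) (σ (c + i + 1)) * w (σ (c + i + 1)) =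
      (∏ i ∈ Finset.range M, k (σ (c + i)) (σ (c + i + 1)) * w (σ (c + i + 1))) *
        ∏ i ∈ Finset.range M', k (σ (c + M + i)) (σ (c + M + i + 1)) * w (σ (c + M + i + 1)) := by
  rw [Finset.prod_range_add]
  congr 1
  refine Finset.prod_congr rfl fun i _ => ?_
  have : c + ((M + i : ℕ) : ℤ) = c + M + i := by push_cast; ring
  rw [this]

/-! ### The pointwise transfer operator -/

/-- `x ↦ ∫⁻ k(x,y) w(y) F(y) dν(y)` is measurable for measurable data. [folklore] -/
theorem measurable_transferStep [SFinite ν] (hk : Measurable (uncurry k)) (hw : Measurable w)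
    {F : S → ℝ≥0∞} (hF : Measurable F) :
    Measurable fun x => ∫⁻ y, k x y * w y * F y ∂ν := by
  have h : Measurable fun p : S × S => k p.1 p.2 * w p.2 * F p.2 :=
    (hk.mul (hw.comp measurable_snd)).mul (hF.comp measurable_snd)
  exact h.lintegral_prod_right'

/-- All iterates `κ^M F` of the pointwise transfer operator are measurable. [folklore] -/
theorem measurable_transferStep_iterate [SFinite ν] (hk : Measurable (uncurry k))
    (hw : Measurable w) {F : S → ℝ≥0∞} (hF : Measurable F) (M : ℕ) :
    Measurable ((fun G : S → ℝ≥0∞ => fun x => ∫⁻ y, k x y * w y * G y ∂ν)^[M] F) := by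
  induction M with
  | zero => simpa using hF
  | succ M ih =>
    rw [Function.iterate_succ_apply']
    exact measurable_transferStep hk hw ih

/-! ### Peeling -/

/-- A marginal integral over `s` only sees the integrand on configurations agreeing with the base
point off `s`. [folklore] -/
theorem lmarginal_congr_of_forall_eq {μ : ℤ → Measure S} {f g : (ℤ → S) → ℝ≥0∞} {s : Finset ℤ}
    (η : ℤ → S) (h : ∀ σ : ℤ → S, (∀ x ∉ s, σ x = η x) → f σ = g σ) :
    (∫⋯∫⁻_s, f ∂μ) η = (∫⋯∫⁻_s, g ∂μ) η := by
  unfold lmarginal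
  refine lintegral_congr fun ζ => h _ fun x hx => ?_
  rw [Function.updateFinset_def]
  simp only [dif_neg hx]

/-- **Peeling a block down to an iterate of the transfer operator (Markov property).** For
measurable `k, w, F` and every base configuration `η`,
`∫⋯∫⁻_{c+1,…,c+M} (∏_{i<M} k(σ_{c+i}, σ_{c+i+1}) w(σ_{c+i+1})) F(σ_{c+M}) = (κ^M F)(η_c)`,
`(κ G)(x) = ∫⁻ k(x,y) w(y) G(y) dν(y)`: the sites are integrated one by one from the far end, each
integration being one application of `κ` (Georgii 2011, §3.1 / proof of Thm 10.25). [folklore] -/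
theorem lmarginal_Icc_pathWeight_mul [SigmaFinite ν] (hk : Measurable (uncurry k))
    (hw : Measurable w) {F : S → ℝ≥0∞} (hF : Measurable F) (c : ℤ) (M : ℕ) (η : ℤ → S) :
    (∫⋯∫⁻_Finset.Icc (c + 1) (c + M), (fun σ =>
        (∏ i ∈ Finset.range M, k (σ (c + i)) (σ (c + i + 1)) * w (σ (c + i + 1))) * F (σ (c + M)))
      ∂fun _ : ℤ => ν) η =
      ((fun G : S → ℝ≥0∞ => fun x => ∫⁻ y, k x y * w y * G y ∂ν)^[M] F) (η c) := by
  induction M generalizing F with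
  | zero =>
    have hI : Finset.Icc (c + 1) (c + ((0 : ℕ) : ℤ)) = ∅ := by
      ext i; simp only [Finset.mem_Icc, Finset.notMem_empty, iff_false]; push_cast; omega
    rw [hI, lmarginal_empty]
    simp
  | succ M ih =>
    have hset : Finset.Icc (c + 1) (c + ↑(M + 1)) = insert (c + M + 1) (Finset.Icc (c + 1) (c + M)) := by
      ext i; simp only [Finset.mem_insert, Finset.mem_Icc]; push_cast; omega
    have hnot : c + (M : ℤ) + 1 ∉ Finset.Icc (c + 1) (c + M) := by
      simp only [Finset.mem_Icc]; omega
    have hmeas : Measurable fun σ : ℤ → S =>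
        (∏ i ∈ Finset.range (M + 1), k (σ (c + i)) (σ (c + i + 1)) * w (σ (c + i + 1))) *
          F (σ (c + ↑(M + 1))) :=
      (measurable_pathWeight hk hw c (M + 1)).mul (measurable_comp_eval hF _)
    rw [hset, lmarginal_insert' _ hmeas hnot]
    -- the innermost integration is one application of `κ`
    have hinner : (fun σ : ℤ → S => ∫⁻ y,
        (∏ i ∈ Finset.range (M + 1), k ((Function.update σ (c + M + 1) y) (c + i))
            ((Function.update σ (c + M + 1) y) (c + i + 1)) *
          w ((Function.update σ (c + M + 1) y) (c + i + 1))) *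
        F ((Function.update σ (c + M + 1) y) (c + ↑(M + 1))) ∂ν) =
        fun σ => (∏ i ∈ Finset.range M, k (σ (c + i)) (σ (c + i + 1)) * w (σ (c + i + 1))) *
          (fun x => ∫⁻ y, k x y * w y * F y ∂ν) (σ (c + M)) := by
      funext σ
      have hval : ∀ y, (∏ i ∈ Finset.range (M + 1), k ((Function.update σ (c + M + 1) y) (c + i))
            ((Function.update σ (c + M + 1) y) (c + i + 1)) *
          w ((Function.update σ (c + M + 1) y) (c + i + 1))) *
          F ((Function.update σ (c + M + 1) y) (c + ↑(M + 1))) =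
          (∏ i ∈ Finset.range M, k (σ (c + i)) (σ (c + i + 1)) * w (σ (c + i + 1))) *
            (k (σ (c + M)) y * w y * F y) := by
        intro y
        rw [Finset.prod_range_succ]
        have h1 : ∀ i ∈ Finset.range M,
            k ((Function.update σ (c + M + 1) y) (c + i)) ((Function.update σ (c + M + 1) y) (c + i + 1)) *
              w ((Function.update σ (c + M + 1) y) (c + i + 1)) =
            k (σ (c + i)) (σ (c + i + 1)) * w (σ (c + i + 1)) := by
          intro i hi
          rw [Finset.mem_range] at hi
          rw [Function.update_of_ne (by omega), Function.update_of_ne (by omega)]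
        rw [Finset.prod_congr rfl h1]
        have h2 : (Function.update σ (c + M + 1) y) (c + (M : ℕ)) = σ (c + M) :=
          Function.update_of_ne (by omega) _ _
        have h3 : (Function.update σ (c + M + 1) y) (c + (M : ℕ) + 1) = y := Function.update_self _ _ _
        have h4 : (Function.update σ (c + M + 1) y) (c + ↑(M + 1)) = y := by
          rw [show c + ((M + 1 : ℕ) : ℤ) = c + M + 1 by push_cast; ring]
          exact Function.update_self _ _ _
        rw [h2, h3, h4]
        ring
      simp_rw [hval]
      exact lintegral_const_mul _ ((hk.of_uncurry_left.mul hw).mul hF)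
    rw [hinner, ih (measurable_transferStep hk hw hF), Function.iterate_succ_apply]

end Literature.MathematicalPhysics.KineticTheory.HeatConduction

end
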